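import Summits.QuantumFields.BalabanUV.Beta.FP.TorusCompositeInsertionPeriodicTwoSym
import Summits.QuantumFields.BalabanUV.Beta.FP.TorusCompositeInsertionPeriodicTwo
import Summits.QuantumFields.BalabanUV.Beta.FP.PeriodisedSymBorderIndexWard

/-!
# `BalabanUV.Beta.FP.TorusCompositeClausesInhabited` — road «FP» for binder row D1, ROUTE T (rooted chain and (β1) «sym» column): **THE GENERIC CLAUSE LETTERS
# OF THE COMPOSITE ROWS ∕ INSERTION FUNCTIONALS ARE JOINTLY INHABITED** — the satisfiability leg of R-FP-76 (d) for every statement of the column that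
# displays `hR0 ∕ hRsucc` (`𝓡`), `h0 ∕ hsucc` (`𝓘`, `𝓘₁`), `h0₂ ∕ hsucc₂` (`𝓘₂`), rooted or sym, and for the order-1 kernel-form letters `hVt ∕ hS ∕ hT ∕ h𝓥` at depth 1

WHY.  After E-FP-34-1 (the OWNER d1-p3 g34: the comb-tower level binder `hlev : ∀ i, lev i = lev (i + 1) + 1` displayed by 26 tower files is
unsatisfiable, so those statements are vacuous as stated) the OWNER's R-FP-76 (d) adds «is every displayed hypothesis satisfiable at the record?» to the
junction checklist.  The rows ∕ insertion junctions of ROUTE T (`TorusCompositeRowsSymPeriodic`, `TorusCompositeInsertionPeriodic(Sym)`,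
`…PeriodicTwo(Sym)`, `…Kernel(Sym)`, `…KernelTwo(Sym)`, `…KernelSingle(Sym)`, `…KernelPacked(Sym)`, `TorusCompositeRowsLatticeSym` — 14 files of this
lineage; the road's tower files consume the lineage's concrete-object rows R-20 ∕ R-22 ∕ R-27 ∕ R-38 and display none of these letters, 0 ∕ 26 by grep)
are typed against GENERIC families `𝓡 ∕ 𝓘 ∕ 𝓘₂` constrained only by CLAUSES (depth `0`, and the top-peeled chain rule at depth `n+1`) — universally
quantified in the level list (and, rooted, the comb-root list).  This file records, once and by name, that those clause packages are JOINTLY INHABITED for every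
block side `Lc`: the witnesses are the functionals defined by recursion on the depth GENERALISING the level (and root) list — exactly what the
top-peeled clauses describe — and every clause then holds by `rfl`.  The periodicity letters `hRper ∕ hper ∕ hper₂` are not clauses: the column
DERIVES them (`rows_periodic_of_clauses`, `periodic_of_clauses`, `periodic_of_clauses₂`, rooted and sym), so they are inhabited at the witnesses
by those theorems.  §3 adds the order-1 KERNEL-FORM letters at depth `1`: for every level list there are a border family `𝓥` and windows `W`
with the block covariance `hVt`, the supports `hS ∕ hT` and the kernel-functional identity `h𝓥` of `TorusCompositeInsertionKernelSym` ∕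
`…KernelSingleSym` (resp. the rooted `…Kernel` ∕ `…KernelSingle`, given a comb-root list in the box) — the witnesses being the RECORD's one-step
objects: an1's packed symmetrised (resp. rooted) table `symVhSAt (ctr (d+1) Lc)` (resp. `vhSAt (toSite (rs 1))`) times the depth-1 unit, the
windows `nearBox Lc (blk Lc x)`, an1's `symVhSAt_translate ∕ vhSAt_translate`, the supports `symVhKerAt_eq_zero_left ∕ _right` through the packer,
and `symVhSAt_zsmul_inr_inl ∕ vhSAt_zsmul_inr_inl`.  Consequently NONE of the column's clause-typed statements is vacuous, and an X-reader's ∕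
consumer's R-FP-76 (d) line for them is `obtain ⟨𝓡, 𝓘, 𝓘₂, hR0, hRsucc, h0, hsucc, h0₂, hsucc₂⟩ := sym_clauses_inhabited Lc` (whoever closes the
(S3-2) sockets THROUGH these junctions names an2's functionals instead and proves the clauses for them — this file does not do that).

WHAT THIS FILE DOES NOT DO.  It fixes NO model of record (the witnesses are ∃-packaged and define nothing; an2's typed recursions remain the objects
the road names), proves no estimate, and says nothing about the kernel-form letters at depth ≥ 2 (there the border family is an2 ∕ an4's packed
composite kernel — the (S3-2) ∕ J-RISK-3′ sockets — whose block covariance and windows are their files' business).  [folklore] throughout: primitive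
recursion and the cited an1 lemmas BY NAME; nothing of the dictionary ∕ Bałaban's is read, asserted or adjudicated; no `def`; nothing admitted.

HONEST: bookkeeping over OUR typed letters; 0 estimates; 0∕4 row-D1 binders (hW, hR, D1Tel, D1Rep); NOT (C1), NOT (T-ID), NOT SDF, NOT D1, NOT
BetaPertH, NOT continuum, NOT Clay.  HONEST DEPENDENCY: continuum YM on T⁴ ⇐ BetaPertH ∧ nine spine estimates (0/9 proved); BetaPertH ⇐ (D1) ∧ (D4)
∧ CAP+tail; G-an2-4 gates asym, D1 and NE2/3/4.
-/

noncomputable section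

open scoped BigOperators

namespace Summit.QuantumFields.BalabanUV.Beta.FP.TorusCompositeClausesInhabited

open Matrix Finset
open Literature.MathematicalPhysics.QuantumFieldTheory
open Literature.MathematicalPhysics.QuantumFieldTheory.Balaban1983to89
open Literature.MathematicalPhysics.QuantumFieldTheory.Balaban1983to89.Beta
open ExpKernelCalculus (MKer shiftK)
open AffineAveraging (Site Form1 box toSite)
open AveragingContours (blk)
open AveragingContoursRooted (ctr ctrOff ctrOff_mem_box linAvgAt linAvgAt_sub)
open AveragingHessianKernels (Bond)
open AveragingHessianKernelsRooted (vhKerAt vhSAt vhSAt_translate)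
open AveragingMixedJetTables (vh2KerAt)
open OneStepResolventKernel (Fib)
open Summit.QuantumFields.BalabanUV.Beta.BorderedHessian (stepScale)
open Summit.QuantumFields.BalabanUV.Beta.SymAveragingHessianCounts (symVhKerAt symLinKerAt symVhSAt symVhSAt_translate)
open Summit.QuantumFields.BalabanUV.Beta.SymAveragingMixedJetTables (symVh2KerAt)
open Summit.QuantumFields.BalabanUV.Beta.CompositeAveragingCoarseExact (compLinAvgAt compLinAvgAt_zero)
open Summit.QuantumFields.BalabanUV.Beta.FP.TorusGaugeCovariance (nearBox)
open Summit.QuantumFields.BalabanUV.Beta.FP.TorusStepInsertionPeriodic (vhSAt_zsmul_inr_inl)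
open Summit.QuantumFields.BalabanUV.Beta.FP.TorusStepInsertionSym (symVhSAt_zsmul_inr_inl)
open Summit.QuantumFields.BalabanUV.Beta.GAN24.BorderGaugeLegContact (vhSAt_inr_inl_eq_zero_of_not_mem)
open Summit.QuantumFields.BalabanUV.Beta.FP.PeriodisedBorderWardContact (vhSAt_inr_inl_eq_zero_of_not_mem_family)
open Summit.QuantumFields.BalabanUV.Beta.FP.PeriodisedSymBorderIndexWard (symVhSAt_inr_inl_eq_zero_of_not_mem symVhSAt_inr_inl_eq_zero_of_not_mem_family)

variable {d : ℕ} (Lc : ℕ)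

/-! ## §1 The (β1) sym column: `𝓡`, `𝓘 ∕ 𝓘₁`, `𝓘₂` jointly -/

/-- [folklore] **THE SYM ROWS CLAUSES ARE INHABITED**: for every block side `Lc` there is a family `𝓡 lev n : Form1 → Form1` with `hR0` (depth `0` is
the identity) and `hRsucc` (the top-peeled sym one-step law of `TorusCompositeRowsSymPeriodic` §3) — the functional defined by recursion on the depth
generalising the level list; both clauses hold by `rfl`. -/
theorem sym_rows_clauses_inhabited :
    ∃ 𝓡 : (ℕ → ℕ) → ℕ → Form1 (d + 1) ℝ → Form1 (d + 1) ℝ,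
      (∀ (lev : ℕ → ℕ) (B : Form1 (d + 1) ℝ), 𝓡 lev 0 B = B) ∧
      (∀ (lev : ℕ → ℕ) (n : ℕ) (B : Form1 (d + 1) ℝ) (κ : Fin (d + 1)) (x : Site (d + 1)),
        𝓡 lev (n + 1) B κ x = stepScale d Lc (lev 1) * ((Lc : ℝ) ^ (d + 1)
          * ∑' z : Site (d + 1), ∑ l : Fin (d + 1), symLinKerAt (ctr (d + 1) Lc) Lc κ x (l, z) * 𝓡 (fun k => lev (k + 1)) n B l z)) :=
  ⟨fun lev n B =>
    Nat.rec (motive := fun _ => (ℕ → ℕ) → Form1 (d + 1) ℝ → Form1 (d + 1) ℝ) (fun _ B => B)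
      (fun _ ih lev B => fun κ x => stepScale d Lc (lev 1) * ((Lc : ℝ) ^ (d + 1)
          * ∑' z : Site (d + 1), ∑ l : Fin (d + 1), symLinKerAt (ctr (d + 1) Lc) Lc κ x (l, z) * ih (fun k => lev (k + 1)) B l z)) n lev B,
    fun _ _ => rfl, fun _ _ _ _ _ => rfl⟩

/-- [folklore] **THE SYM CLAUSE PACKAGE `hR0 ∕ hRsucc ∕ h0 ∕ hsucc ∕ h0₂ ∕ hsucc₂` IS JOINTLY INHABITED** (the letters of `TorusCompositeInsertionPeriodicSym`
§3 and `TorusCompositeInsertionPeriodicTwoSym` §1, hence of every sym kernel-junction statement of this lineage typed against them): witnesses by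
recursion on the depth generalising the level list, the order-1 witness built over the rows witness and the order-2 witness over both; all six
clauses by `rfl`.  With `rows_periodic_of_clauses ∕ periodic_of_clauses ∕ periodic_of_clauses₂` this inhabits `hRper ∕ hper ∕ hper₂` too. -/
theorem sym_clauses_inhabited :
    ∃ (𝓡 : (ℕ → ℕ) → ℕ → Form1 (d + 1) ℝ → Form1 (d + 1) ℝ) (𝓘 : (ℕ → ℕ) → ℕ → Form1 (d + 1) ℝ → Form1 (d + 1) ℝ → Form1 (d + 1) ℝ)
      (𝓘₂ : (ℕ → ℕ) → ℕ → Form1 (d + 1) ℝ → Form1 (d + 1) ℝ → Form1 (d + 1) ℝ → Form1 (d + 1) ℝ),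
      (∀ (lev : ℕ → ℕ) (B : Form1 (d + 1) ℝ), 𝓡 lev 0 B = B) ∧
      (∀ (lev : ℕ → ℕ) (n : ℕ) (B : Form1 (d + 1) ℝ) (κ : Fin (d + 1)) (x : Site (d + 1)),
        𝓡 lev (n + 1) B κ x = stepScale d Lc (lev 1) * ((Lc : ℝ) ^ (d + 1)
          * ∑' z : Site (d + 1), ∑ l : Fin (d + 1), symLinKerAt (ctr (d + 1) Lc) Lc κ x (l, z) * 𝓡 (fun k => lev (k + 1)) n B l z)) ∧
      (∀ (lev : ℕ → ℕ) (H B : Form1 (d + 1) ℝ), 𝓘 lev 0 H B = 0) ∧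
      (∀ (lev : ℕ → ℕ) (n : ℕ) (H B : Form1 (d + 1) ℝ) (κ : Fin (d + 1)) (x : Site (d + 1)),
        𝓘 lev (n + 1) H B κ x
          = (((Lc : ℝ) ^ (d + 1) * stepScale d Lc (lev 1)) * (∏ i ∈ Finset.range n, (stepScale d Lc (lev (i + 1 + 1)) * ((box (d + 1) Lc).card : ℝ)))⁻¹) *
              (∑' u : Site (d + 1), ∑ κ' : Fin (d + 1),
                (∑' z : Site (d + 1), ∑ l : Fin (d + 1), symVhKerAt (ctr (d + 1) Lc) Lc κ x (l, z) (κ', u) * 𝓡 (fun k => lev (k + 1)) n B l z) *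
                  𝓡 (fun k => lev (k + 1)) n H κ' u)
            + stepScale d Lc (lev 1) * ((Lc : ℝ) ^ (d + 1) *
                ∑' z : Site (d + 1), ∑ l : Fin (d + 1), symLinKerAt (ctr (d + 1) Lc) Lc κ x (l, z) * 𝓘 (fun k => lev (k + 1)) n H B l z)) ∧
      (∀ (lev : ℕ → ℕ) (H H' B : Form1 (d + 1) ℝ), 𝓘₂ lev 0 H H' B = 0) ∧
      (∀ (lev : ℕ → ℕ) (n : ℕ) (H H' B : Form1 (d + 1) ℝ) (κ₀ : Fin (d + 1)) (x : Site (d + 1)),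
        𝓘₂ lev (n + 1) H H' B κ₀ x
          = ((((Lc : ℝ) ^ (d + 1) * stepScale d Lc (lev 1)) * (∏ i ∈ Finset.range n, (stepScale d Lc (lev (i + 1 + 1)) * ((box (d + 1) Lc).card : ℝ)))⁻¹)
              * (∏ i ∈ Finset.range n, (stepScale d Lc (lev (i + 1 + 1)) * ((box (d + 1) Lc).card : ℝ)))⁻¹) *
              (∑' u : Site (d + 1), ∑ κ : Fin (d + 1), (∑' u' : Site (d + 1), ∑ κ' : Fin (d + 1),
                (∑' z : Site (d + 1), ∑ l : Fin (d + 1),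
                  (1 / 2 : ℝ) * (symVh2KerAt (ctr (d + 1) Lc) Lc κ₀ x (l, z) (κ, u) (κ', u') + symVh2KerAt (ctr (d + 1) Lc) Lc κ₀ x (l, z) (κ', u') (κ, u)) *
                    𝓡 (fun k => lev (k + 1)) n B l z) *
                𝓡 (fun k => lev (k + 1)) n H' κ' u') * 𝓡 (fun k => lev (k + 1)) n H κ u)
            + (((Lc : ℝ) ^ (d + 1) * stepScale d Lc (lev 1)) * (∏ i ∈ Finset.range n, (stepScale d Lc (lev (i + 1 + 1)) * ((box (d + 1) Lc).card : ℝ)))⁻¹) *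
              ((∑' u : Site (d + 1), ∑ κ' : Fin (d + 1),
                (∑' z : Site (d + 1), ∑ l : Fin (d + 1), symVhKerAt (ctr (d + 1) Lc) Lc κ₀ x (l, z) (κ', u) * 𝓘 (fun k => lev (k + 1)) n H' B l z) *
                  𝓡 (fun k => lev (k + 1)) n H κ' u)
              + (∑' u : Site (d + 1), ∑ κ' : Fin (d + 1),
                (∑' z : Site (d + 1), ∑ l : Fin (d + 1), symVhKerAt (ctr (d + 1) Lc) Lc κ₀ x (l, z) (κ', u) * 𝓘 (fun k => lev (k + 1)) n H B l z) *
                  𝓡 (fun k => lev (k + 1)) n H' κ' u))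
            + stepScale d Lc (lev 1) * ((Lc : ℝ) ^ (d + 1) *
                ∑' z : Site (d + 1), ∑ l : Fin (d + 1), symLinKerAt (ctr (d + 1) Lc) Lc κ₀ x (l, z) * 𝓘₂ (fun k => lev (k + 1)) n H H' B l z)) := by
  let R : (ℕ → ℕ) → ℕ → Form1 (d + 1) ℝ → Form1 (d + 1) ℝ := fun lev n B =>
    Nat.rec (motive := fun _ => (ℕ → ℕ) → Form1 (d + 1) ℝ → Form1 (d + 1) ℝ) (fun _ B => B)
      (fun _ ih lev B => fun κ x => stepScale d Lc (lev 1) * ((Lc : ℝ) ^ (d + 1)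
          * ∑' z : Site (d + 1), ∑ l : Fin (d + 1), symLinKerAt (ctr (d + 1) Lc) Lc κ x (l, z) * ih (fun k => lev (k + 1)) B l z)) n lev B
  let I : (ℕ → ℕ) → ℕ → Form1 (d + 1) ℝ → Form1 (d + 1) ℝ → Form1 (d + 1) ℝ := fun lev n H B =>
    Nat.rec (motive := fun _ => (ℕ → ℕ) → Form1 (d + 1) ℝ → Form1 (d + 1) ℝ → Form1 (d + 1) ℝ) (fun _ _ _ => 0)
      (fun n ih lev H B => fun κ x =>
        (((Lc : ℝ) ^ (d + 1) * stepScale d Lc (lev 1)) * (∏ i ∈ Finset.range n, (stepScale d Lc (lev (i + 1 + 1)) * ((box (d + 1) Lc).card : ℝ)))⁻¹) *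
              (∑' u : Site (d + 1), ∑ κ' : Fin (d + 1),
                (∑' z : Site (d + 1), ∑ l : Fin (d + 1), symVhKerAt (ctr (d + 1) Lc) Lc κ x (l, z) (κ', u) * R (fun k => lev (k + 1)) n B l z) *
                  R (fun k => lev (k + 1)) n H κ' u)
            + stepScale d Lc (lev 1) * ((Lc : ℝ) ^ (d + 1) *
                ∑' z : Site (d + 1), ∑ l : Fin (d + 1), symLinKerAt (ctr (d + 1) Lc) Lc κ x (l, z) * ih (fun k => lev (k + 1)) H B l z)) n lev H B
  let I2 : (ℕ → ℕ) → ℕ → Form1 (d + 1) ℝ → Form1 (d + 1) ℝ → Form1 (d + 1) ℝ → Form1 (d + 1) ℝ := fun lev n H H' B =>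
    Nat.rec (motive := fun _ => (ℕ → ℕ) → Form1 (d + 1) ℝ → Form1 (d + 1) ℝ → Form1 (d + 1) ℝ → Form1 (d + 1) ℝ) (fun _ _ _ _ => 0)
      (fun n ih lev H H' B => fun κ₀ x =>
        ((((Lc : ℝ) ^ (d + 1) * stepScale d Lc (lev 1)) * (∏ i ∈ Finset.range n, (stepScale d Lc (lev (i + 1 + 1)) * ((box (d + 1) Lc).card : ℝ)))⁻¹)
              * (∏ i ∈ Finset.range n, (stepScale d Lc (lev (i + 1 + 1)) * ((box (d + 1) Lc).card : ℝ)))⁻¹) *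
              (∑' u : Site (d + 1), ∑ κ : Fin (d + 1), (∑' u' : Site (d + 1), ∑ κ' : Fin (d + 1),
                (∑' z : Site (d + 1), ∑ l : Fin (d + 1),
                  (1 / 2 : ℝ) * (symVh2KerAt (ctr (d + 1) Lc) Lc κ₀ x (l, z) (κ, u) (κ', u') + symVh2KerAt (ctr (d + 1) Lc) Lc κ₀ x (l, z) (κ', u') (κ, u)) *
                    R (fun k => lev (k + 1)) n B l z) *
                R (fun k => lev (k + 1)) n H' κ' u') * R (fun k => lev (k + 1)) n H κ u)
            + (((Lc : ℝ) ^ (d + 1) * stepScale d Lc (lev 1)) * (∏ i ∈ Finset.range n, (stepScale d Lc (lev (i + 1 + 1)) * ((box (d + 1) Lc).card : ℝ)))⁻¹) *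
              ((∑' u : Site (d + 1), ∑ κ' : Fin (d + 1),
                (∑' z : Site (d + 1), ∑ l : Fin (d + 1), symVhKerAt (ctr (d + 1) Lc) Lc κ₀ x (l, z) (κ', u) * I (fun k => lev (k + 1)) n H' B l z) *
                  R (fun k => lev (k + 1)) n H κ' u)
              + (∑' u : Site (d + 1), ∑ κ' : Fin (d + 1),
                (∑' z : Site (d + 1), ∑ l : Fin (d + 1), symVhKerAt (ctr (d + 1) Lc) Lc κ₀ x (l, z) (κ', u) * I (fun k => lev (k + 1)) n H B l z) *
                  R (fun k => lev (k + 1)) n H' κ' u))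
            + stepScale d Lc (lev 1) * ((Lc : ℝ) ^ (d + 1) *
                ∑' z : Site (d + 1), ∑ l : Fin (d + 1), symLinKerAt (ctr (d + 1) Lc) Lc κ₀ x (l, z) * ih (fun k => lev (k + 1)) H H' B l z)) n lev H H' B
  exact ⟨R, I, I2, fun _ _ => rfl, fun _ _ _ _ _ => rfl, fun _ _ _ => rfl, fun _ _ _ _ _ _ => rfl, fun _ _ _ _ => rfl, fun _ _ _ _ _ _ _ => rfl⟩

/-! ## §2 The rooted chain: `𝓘 lev rs`, `𝓘₂ lev rs` jointly -/

/-- [folklore] **THE ROOTED CLAUSE PACKAGE `h0 ∕ hsucc ∕ h0₂ ∕ hsucc₂` IS JOINTLY INHABITED** (the letters of `TorusCompositeInsertionPeriodic` §3 ∕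
`TorusCompositeInsertionPeriodicTwo` §1 — rooted one-step kernels `vhKerAt ∕ vh2KerAt (toSite (rs 1))`, lower rows an2's `compLinAvgAt`, top
average `linAvgAt`): witnesses by recursion on the depth generalising the level AND root lists; all four clauses by `rfl`.  With the rooted
`periodic_of_clauses ∕ periodic_of_clauses₂` this inhabits the rooted `hper ∕ hper₁ ∕ hper₂` too. -/
theorem rooted_clauses_inhabited :
    ∃ (𝓘 : (ℕ → ℕ) → (ℕ → (Fin (d + 1) → ℕ)) → ℕ → Form1 (d + 1) ℝ → Form1 (d + 1) ℝ → Form1 (d + 1) ℝ)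
      (𝓘₂ : (ℕ → ℕ) → (ℕ → (Fin (d + 1) → ℕ)) → ℕ → Form1 (d + 1) ℝ → Form1 (d + 1) ℝ → Form1 (d + 1) ℝ → Form1 (d + 1) ℝ),
      (∀ (lev : ℕ → ℕ) (rs : ℕ → (Fin (d + 1) → ℕ)) (H B : Form1 (d + 1) ℝ), 𝓘 lev rs 0 H B = 0) ∧
      (∀ (lev : ℕ → ℕ) (rs : ℕ → (Fin (d + 1) → ℕ)) (n : ℕ) (H B : Form1 (d + 1) ℝ) (κ : Fin (d + 1)) (x : Site (d + 1)),
        𝓘 lev rs (n + 1) H B κ x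
          = (((Lc : ℝ) ^ (d + 1) * stepScale d Lc (lev 1)) * (∏ i ∈ Finset.range n, (stepScale d Lc (lev (i + 1 + 1)) * ((box (d + 1) Lc).card : ℝ)))⁻¹) *
              (∑' u : Site (d + 1), ∑ κ' : Fin (d + 1),
                (∑' z : Site (d + 1), ∑ l : Fin (d + 1), vhKerAt (toSite (rs 1)) Lc κ x (l, z) (κ', u) *
                  ((∏ i ∈ Finset.range n, stepScale d Lc (lev (i + 1 + 1))) * compLinAvgAt (fun i => rs (n - i + 1)) Lc n B l z)) *
                ((∏ i ∈ Finset.range n, stepScale d Lc (lev (i + 1 + 1))) * compLinAvgAt (fun i => rs (n - i + 1)) Lc n H κ' u))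
            + stepScale d Lc (lev 1) * linAvgAt (toSite (rs 1)) (𝓘 (fun k => lev (k + 1)) (fun k => rs (k + 1)) n H B) Lc κ x) ∧
      (∀ (lev : ℕ → ℕ) (rs : ℕ → (Fin (d + 1) → ℕ)) (H H' B : Form1 (d + 1) ℝ), 𝓘₂ lev rs 0 H H' B = 0) ∧
      (∀ (lev : ℕ → ℕ) (rs : ℕ → (Fin (d + 1) → ℕ)) (n : ℕ) (H H' B : Form1 (d + 1) ℝ) (κ₀ : Fin (d + 1)) (x : Site (d + 1)),
        𝓘₂ lev rs (n + 1) H H' B κ₀ x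
          = ((((Lc : ℝ) ^ (d + 1) * stepScale d Lc (lev 1)) * (∏ i ∈ Finset.range n, (stepScale d Lc (lev (i + 1 + 1)) * ((box (d + 1) Lc).card : ℝ)))⁻¹) * (∏ i ∈ Finset.range n, (stepScale d Lc (lev (i + 1 + 1)) * ((box (d + 1) Lc).card : ℝ)))⁻¹) *
              (∑' u : Site (d + 1), ∑ κ : Fin (d + 1), (∑' u' : Site (d + 1), ∑ κ' : Fin (d + 1),
                (∑' z : Site (d + 1), ∑ l : Fin (d + 1),
                  (1 / 2 : ℝ) * (vh2KerAt (toSite (rs 1)) Lc κ₀ x (l, z) (κ, u) (κ', u') + vh2KerAt (toSite (rs 1)) Lc κ₀ x (l, z) (κ', u') (κ, u)) *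
                    ((∏ i ∈ Finset.range n, stepScale d Lc (lev (i + 1 + 1))) * compLinAvgAt (fun i => rs (n - i + 1)) Lc n B l z)) *
                ((∏ i ∈ Finset.range n, stepScale d Lc (lev (i + 1 + 1))) * compLinAvgAt (fun i => rs (n - i + 1)) Lc n H' κ' u')) *
                ((∏ i ∈ Finset.range n, stepScale d Lc (lev (i + 1 + 1))) * compLinAvgAt (fun i => rs (n - i + 1)) Lc n H κ u))
            + (((Lc : ℝ) ^ (d + 1) * stepScale d Lc (lev 1)) * (∏ i ∈ Finset.range n, (stepScale d Lc (lev (i + 1 + 1)) * ((box (d + 1) Lc).card : ℝ)))⁻¹) *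
              ((∑' u : Site (d + 1), ∑ κ' : Fin (d + 1),
                (∑' z : Site (d + 1), ∑ l : Fin (d + 1), vhKerAt (toSite (rs 1)) Lc κ₀ x (l, z) (κ', u) * 𝓘 (fun k => lev (k + 1)) (fun k => rs (k + 1)) n H' B l z) *
                  ((∏ i ∈ Finset.range n, stepScale d Lc (lev (i + 1 + 1))) * compLinAvgAt (fun i => rs (n - i + 1)) Lc n H κ' u))
              + (∑' u : Site (d + 1), ∑ κ' : Fin (d + 1),
                (∑' z : Site (d + 1), ∑ l : Fin (d + 1), vhKerAt (toSite (rs 1)) Lc κ₀ x (l, z) (κ', u) * 𝓘 (fun k => lev (k + 1)) (fun k => rs (k + 1)) n H B l z) *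
                  ((∏ i ∈ Finset.range n, stepScale d Lc (lev (i + 1 + 1))) * compLinAvgAt (fun i => rs (n - i + 1)) Lc n H' κ' u)))
            + stepScale d Lc (lev 1) * linAvgAt (toSite (rs 1)) (𝓘₂ (fun k => lev (k + 1)) (fun k => rs (k + 1)) n H H' B) Lc κ₀ x) := by
  let I : (ℕ → ℕ) → (ℕ → (Fin (d + 1) → ℕ)) → ℕ → Form1 (d + 1) ℝ → Form1 (d + 1) ℝ → Form1 (d + 1) ℝ := fun lev rs n H B =>
    Nat.rec (motive := fun _ => (ℕ → ℕ) → (ℕ → (Fin (d + 1) → ℕ)) → Form1 (d + 1) ℝ → Form1 (d + 1) ℝ → Form1 (d + 1) ℝ) (fun _ _ _ _ => 0)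
      (fun n ih lev rs H B => fun κ x =>
        (((Lc : ℝ) ^ (d + 1) * stepScale d Lc (lev 1)) * (∏ i ∈ Finset.range n, (stepScale d Lc (lev (i + 1 + 1)) * ((box (d + 1) Lc).card : ℝ)))⁻¹) *
              (∑' u : Site (d + 1), ∑ κ' : Fin (d + 1),
                (∑' z : Site (d + 1), ∑ l : Fin (d + 1), vhKerAt (toSite (rs 1)) Lc κ x (l, z) (κ', u) *
                  ((∏ i ∈ Finset.range n, stepScale d Lc (lev (i + 1 + 1))) * compLinAvgAt (fun i => rs (n - i + 1)) Lc n B l z)) *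
                ((∏ i ∈ Finset.range n, stepScale d Lc (lev (i + 1 + 1))) * compLinAvgAt (fun i => rs (n - i + 1)) Lc n H κ' u))
            + stepScale d Lc (lev 1) * linAvgAt (toSite (rs 1)) (ih (fun k => lev (k + 1)) (fun k => rs (k + 1)) H B) Lc κ x) n lev rs H B
  let I2 : (ℕ → ℕ) → (ℕ → (Fin (d + 1) → ℕ)) → ℕ → Form1 (d + 1) ℝ → Form1 (d + 1) ℝ → Form1 (d + 1) ℝ → Form1 (d + 1) ℝ := fun lev rs n H H' B =>
    Nat.rec (motive := fun _ => (ℕ → ℕ) → (ℕ → (Fin (d + 1) → ℕ)) → Form1 (d + 1) ℝ → Form1 (d + 1) ℝ → Form1 (d + 1) ℝ → Form1 (d + 1) ℝ) (fun _ _ _ _ _ => 0)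
      (fun n ih lev rs H H' B => fun κ₀ x =>
        ((((Lc : ℝ) ^ (d + 1) * stepScale d Lc (lev 1)) * (∏ i ∈ Finset.range n, (stepScale d Lc (lev (i + 1 + 1)) * ((box (d + 1) Lc).card : ℝ)))⁻¹) * (∏ i ∈ Finset.range n, (stepScale d Lc (lev (i + 1 + 1)) * ((box (d + 1) Lc).card : ℝ)))⁻¹) *
              (∑' u : Site (d + 1), ∑ κ : Fin (d + 1), (∑' u' : Site (d + 1), ∑ κ' : Fin (d + 1),
                (∑' z : Site (d + 1), ∑ l : Fin (d + 1),
                  (1 / 2 : ℝ) * (vh2KerAt (toSite (rs 1)) Lc κ₀ x (l, z) (κ, u) (κ', u') + vh2KerAt (toSite (rs 1)) Lc κ₀ x (l, z) (κ', u') (κ, u)) *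
                    ((∏ i ∈ Finset.range n, stepScale d Lc (lev (i + 1 + 1))) * compLinAvgAt (fun i => rs (n - i + 1)) Lc n B l z)) *
                ((∏ i ∈ Finset.range n, stepScale d Lc (lev (i + 1 + 1))) * compLinAvgAt (fun i => rs (n - i + 1)) Lc n H' κ' u')) *
                ((∏ i ∈ Finset.range n, stepScale d Lc (lev (i + 1 + 1))) * compLinAvgAt (fun i => rs (n - i + 1)) Lc n H κ u))
            + (((Lc : ℝ) ^ (d + 1) * stepScale d Lc (lev 1)) * (∏ i ∈ Finset.range n, (stepScale d Lc (lev (i + 1 + 1)) * ((box (d + 1) Lc).card : ℝ)))⁻¹) *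
              ((∑' u : Site (d + 1), ∑ κ' : Fin (d + 1),
                (∑' z : Site (d + 1), ∑ l : Fin (d + 1), vhKerAt (toSite (rs 1)) Lc κ₀ x (l, z) (κ', u) * I (fun k => lev (k + 1)) (fun k => rs (k + 1)) n H' B l z) *
                  ((∏ i ∈ Finset.range n, stepScale d Lc (lev (i + 1 + 1))) * compLinAvgAt (fun i => rs (n - i + 1)) Lc n H κ' u))
              + (∑' u : Site (d + 1), ∑ κ' : Fin (d + 1),
                (∑' z : Site (d + 1), ∑ l : Fin (d + 1), vhKerAt (toSite (rs 1)) Lc κ₀ x (l, z) (κ', u) * I (fun k => lev (k + 1)) (fun k => rs (k + 1)) n H B l z) *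
                  ((∏ i ∈ Finset.range n, stepScale d Lc (lev (i + 1 + 1))) * compLinAvgAt (fun i => rs (n - i + 1)) Lc n H' κ' u)))
            + stepScale d Lc (lev 1) * linAvgAt (toSite (rs 1)) (ih (fun k => lev (k + 1)) (fun k => rs (k + 1)) H H' B) Lc κ₀ x) n lev rs H H' B
  exact ⟨I, I2, fun _ _ _ _ => rfl, fun _ _ _ _ _ _ _ => rfl, fun _ _ _ _ _ => rfl, fun _ _ _ _ _ _ _ _ => rfl⟩

/-! ## §3 The order-1 kernel-form letters at depth `1`, by the record's one-step objects -/

section DepthOne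

variable [NeZero Lc]

/-- [folklore] **THE SYM ORDER-1 KERNEL-FORM LETTERS ARE JOINTLY INHABITED AT DEPTH 1, TOGETHER WITH THE CLAUSES** (the hypotheses of
`TorusCompositeInsertionKernelSym.sum_mul_perZ_dper_eq_compIns₁Sym_apply` ∕ `…KernelSingleSym.perZ_dper_eq_compIns₁Sym_apply_single` at `n := 1`):
for the §1 witnesses `𝓡 ∕ 𝓘` and EVERY level list there are a border family `𝓥` and windows `W` with `hVt ∕ hS ∕ hT ∕ h𝓥` — namely
`𝓥 κ′ u := c₁ • symVhSAt (ctr (d+1) Lc) d Lc rfl κ′ u` (`c₁` the depth-1 unit of `hsucc`), `W x := nearBox Lc (blk Lc x)`; `hVt` is an1's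
`symVhSAt_translate`, `hS ∕ hT` are `symVhKerAt_eq_zero_left ∕ _right` through the packer (`PeriodisedSymBorderIndexWard`), `h𝓥` is `hsucc` at depth
`0` read through `symVhSAt_zsmul_inr_inl`. -/
theorem sym_kernel_letters_inhabited_depthOne :
    ∃ (𝓡 : (ℕ → ℕ) → ℕ → Form1 (d + 1) ℝ → Form1 (d + 1) ℝ) (𝓘 : (ℕ → ℕ) → ℕ → Form1 (d + 1) ℝ → Form1 (d + 1) ℝ → Form1 (d + 1) ℝ),
      (∀ (lev : ℕ → ℕ) (B : Form1 (d + 1) ℝ), 𝓡 lev 0 B = B) ∧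
      (∀ (lev : ℕ → ℕ) (n : ℕ) (B : Form1 (d + 1) ℝ) (κ : Fin (d + 1)) (x : Site (d + 1)),
        𝓡 lev (n + 1) B κ x = stepScale d Lc (lev 1) * ((Lc : ℝ) ^ (d + 1)
          * ∑' z : Site (d + 1), ∑ l : Fin (d + 1), symLinKerAt (ctr (d + 1) Lc) Lc κ x (l, z) * 𝓡 (fun k => lev (k + 1)) n B l z)) ∧
      (∀ (lev : ℕ → ℕ) (H B : Form1 (d + 1) ℝ), 𝓘 lev 0 H B = 0) ∧
      (∀ (lev : ℕ → ℕ) (n : ℕ) (H B : Form1 (d + 1) ℝ) (κ : Fin (d + 1)) (x : Site (d + 1)),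
        𝓘 lev (n + 1) H B κ x
          = (((Lc : ℝ) ^ (d + 1) * stepScale d Lc (lev 1)) * (∏ i ∈ Finset.range n, (stepScale d Lc (lev (i + 1 + 1)) * ((box (d + 1) Lc).card : ℝ)))⁻¹) *
              (∑' u : Site (d + 1), ∑ κ' : Fin (d + 1),
                (∑' z : Site (d + 1), ∑ l : Fin (d + 1), symVhKerAt (ctr (d + 1) Lc) Lc κ x (l, z) (κ', u) * 𝓡 (fun k => lev (k + 1)) n B l z) *
                  𝓡 (fun k => lev (k + 1)) n H κ' u)
            + stepScale d Lc (lev 1) * ((Lc : ℝ) ^ (d + 1) *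
                ∑' z : Site (d + 1), ∑ l : Fin (d + 1), symLinKerAt (ctr (d + 1) Lc) Lc κ x (l, z) * 𝓘 (fun k => lev (k + 1)) n H B l z)) ∧
      ∀ lev : ℕ → ℕ, ∃ (𝓥 : Fin (d + 1) → Site (d + 1) → MKer (d + 1) (Fib d)) (W : Site (d + 1) → Finset (Site (d + 1))),
        (∀ (κ' : Fin (d + 1)) (u t : Site (d + 1)), 𝓥 κ' (u + (((Lc ^ 1 : ℕ) : ℤ)) • t) = shiftK (-((((Lc ^ 1 : ℕ) : ℤ)) • t)) (𝓥 κ' u)) ∧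
        (∀ (κ' : Fin (d + 1)) (u x : Site (d + 1)) (μ α : Fin (d + 1)), ∀ z ∉ W x, 𝓥 κ' u x z (Sum.inr μ) (Sum.inl α) = 0) ∧
        (∀ (κ' : Fin (d + 1)) (x z : Site (d + 1)) (μ α : Fin (d + 1)), ∀ u ∉ W x, 𝓥 κ' u x z (Sum.inr μ) (Sum.inl α) = 0) ∧
        (∀ (H B : Form1 (d + 1) ℝ) (κ : Fin (d + 1)) (x : Site (d + 1)),
            (∑' u : Site (d + 1), ∑ κ' : Fin (d + 1),
              (∑' z : Site (d + 1), ∑ l : Fin (d + 1), 𝓥 κ' u ((((Lc ^ 1 : ℕ) : ℤ)) • x) z (Sum.inr κ) (Sum.inl l) * B l z) * H κ' u) = 𝓘 lev 1 H B κ x) := by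
  obtain ⟨R, I, _I2, hR0, hRsucc, h0, hsucc, -, -⟩ := sym_clauses_inhabited (d := d) Lc
  refine ⟨R, I, hR0, hRsucc, h0, hsucc, fun lev => ?_⟩
  have hL : 1 ≤ Lc := Nat.one_le_iff_ne_zero.mpr (NeZero.ne Lc)
  have hc : ctrOff (d + 1) Lc ∈ box (d + 1) Lc := ctrOff_mem_box hL
  have e : (((Lc ^ 1 : ℕ) : ℤ)) = (Lc : ℤ) := by simp
  let c₁ : ℝ := (((Lc : ℝ) ^ (d + 1) * stepScale d Lc (lev 1)) * (∏ i ∈ Finset.range 0, (stepScale d Lc (lev (i + 1 + 1)) * ((box (d + 1) Lc).card : ℝ)))⁻¹)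
  refine ⟨fun κ' u => c₁ • symVhSAt (ctr (d + 1) Lc) d Lc rfl κ' u, fun x => nearBox Lc (blk Lc x), ?_, ?_, ?_, ?_⟩
  · intro κ' u t
    rw [e]
    show c₁ • symVhSAt (ctr (d + 1) Lc) d Lc rfl κ' (u + (Lc : ℤ) • t) = _
    rw [symVhSAt_translate _ hL]
    rfl
  · intro κ' u x μ α z hz
    show c₁ * symVhSAt (toSite (ctrOff (d + 1) Lc)) d Lc rfl κ' u x z (Sum.inr μ) (Sum.inl α) = 0
    rw [symVhSAt_inr_inl_eq_zero_of_not_mem hc κ' u x μ α hz, mul_zero]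
  · intro κ' x z μ α u hu
    show c₁ * symVhSAt (toSite (ctrOff (d + 1) Lc)) d Lc rfl κ' u x z (Sum.inr μ) (Sum.inl α) = 0
    rw [symVhSAt_inr_inl_eq_zero_of_not_mem_family hc κ' x z μ α hu, mul_zero]
  · intro H B κ x
    rw [e, hsucc]
    simp only [hR0, h0, Pi.zero_apply, mul_zero, Finset.sum_const_zero, tsum_zero, add_zero]
    have hV : ∀ (κ' : Fin (d + 1)) (u z : Site (d + 1)) (l : Fin (d + 1)),
        (c₁ • symVhSAt (ctr (d + 1) Lc) d Lc rfl κ' u) ((Lc : ℤ) • x) z (Sum.inr κ) (Sum.inl l) = c₁ * symVhKerAt (ctr (d + 1) Lc) Lc κ x (l, z) (κ', u) := by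
      intro κ' u z l
      show c₁ * symVhSAt (ctr (d + 1) Lc) d Lc rfl κ' u ((Lc : ℤ) • x) z (Sum.inr κ) (Sum.inl l) = _
      rw [symVhSAt_zsmul_inr_inl]
    simp only [hV]
    show _ = c₁ * _
    rw [← tsum_mul_left]
    refine tsum_congr fun u => ?_
    rw [Finset.mul_sum]
    refine Finset.sum_congr rfl fun κ' _ => ?_
    rw [← mul_assoc, ← tsum_mul_left]
    refine congrArg (fun t : ℝ => t * _) (tsum_congr fun z => ?_)
    rw [Finset.mul_sum]
    exact Finset.sum_congr rfl fun l _ => by rw [mul_assoc]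

/-- [folklore] **THE ROOTED ORDER-1 KERNEL-FORM LETTERS ARE JOINTLY INHABITED AT DEPTH 1, TOGETHER WITH THE CLAUSES** (the hypotheses of
`TorusCompositeInsertionKernel.sum_mul_perZ_dper_eq_compIns₁_apply` ∕ `…KernelSingle.perZ_dper_eq_compIns₁_apply_single` at `n := 1`), for the §2
witness `𝓘`, every level list and every comb-root list whose root `rs 1` lies in the box: `𝓥 κ′ u := c₁ • vhSAt (toSite (rs 1)) d Lc rfl κ′ u`,
`W x := nearBox Lc (blk Lc x)`; an1's `vhSAt_translate`, `vhKerAt_eq_zero_left ∕ _right` through the packer, `vhSAt_zsmul_inr_inl`. -/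
theorem rooted_kernel_letters_inhabited_depthOne :
    ∃ (𝓘 : (ℕ → ℕ) → (ℕ → (Fin (d + 1) → ℕ)) → ℕ → Form1 (d + 1) ℝ → Form1 (d + 1) ℝ → Form1 (d + 1) ℝ),
      (∀ (lev : ℕ → ℕ) (rs : ℕ → (Fin (d + 1) → ℕ)) (H B : Form1 (d + 1) ℝ), 𝓘 lev rs 0 H B = 0) ∧
      (∀ (lev : ℕ → ℕ) (rs : ℕ → (Fin (d + 1) → ℕ)) (n : ℕ) (H B : Form1 (d + 1) ℝ) (κ : Fin (d + 1)) (x : Site (d + 1)),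
        𝓘 lev rs (n + 1) H B κ x
          = (((Lc : ℝ) ^ (d + 1) * stepScale d Lc (lev 1)) * (∏ i ∈ Finset.range n, (stepScale d Lc (lev (i + 1 + 1)) * ((box (d + 1) Lc).card : ℝ)))⁻¹) *
              (∑' u : Site (d + 1), ∑ κ' : Fin (d + 1),
                (∑' z : Site (d + 1), ∑ l : Fin (d + 1), vhKerAt (toSite (rs 1)) Lc κ x (l, z) (κ', u) *
                  ((∏ i ∈ Finset.range n, stepScale d Lc (lev (i + 1 + 1))) * compLinAvgAt (fun i => rs (n - i + 1)) Lc n B l z)) *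
                ((∏ i ∈ Finset.range n, stepScale d Lc (lev (i + 1 + 1))) * compLinAvgAt (fun i => rs (n - i + 1)) Lc n H κ' u))
            + stepScale d Lc (lev 1) * linAvgAt (toSite (rs 1)) (𝓘 (fun k => lev (k + 1)) (fun k => rs (k + 1)) n H B) Lc κ x) ∧
      ∀ (lev : ℕ → ℕ) (rs : ℕ → (Fin (d + 1) → ℕ)), rs 1 ∈ box (d + 1) Lc →
        ∃ (𝓥 : Fin (d + 1) → Site (d + 1) → MKer (d + 1) (Fib d)) (W : Site (d + 1) → Finset (Site (d + 1))),
        (∀ (κ' : Fin (d + 1)) (u t : Site (d + 1)), 𝓥 κ' (u + (((Lc ^ 1 : ℕ) : ℤ)) • t) = shiftK (-((((Lc ^ 1 : ℕ) : ℤ)) • t)) (𝓥 κ' u)) ∧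
        (∀ (κ' : Fin (d + 1)) (u x : Site (d + 1)) (μ α : Fin (d + 1)), ∀ z ∉ W x, 𝓥 κ' u x z (Sum.inr μ) (Sum.inl α) = 0) ∧
        (∀ (κ' : Fin (d + 1)) (x z : Site (d + 1)) (μ α : Fin (d + 1)), ∀ u ∉ W x, 𝓥 κ' u x z (Sum.inr μ) (Sum.inl α) = 0) ∧
        (∀ (H B : Form1 (d + 1) ℝ) (κ : Fin (d + 1)) (x : Site (d + 1)),
            (∑' u : Site (d + 1), ∑ κ' : Fin (d + 1),
              (∑' z : Site (d + 1), ∑ l : Fin (d + 1), 𝓥 κ' u ((((Lc ^ 1 : ℕ) : ℤ)) • x) z (Sum.inr κ) (Sum.inl l) * B l z) * H κ' u) = 𝓘 lev rs 1 H B κ x) := by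
  obtain ⟨I, _I2, h0, hsucc, -, -⟩ := rooted_clauses_inhabited (d := d) Lc
  refine ⟨I, h0, hsucc, fun lev rs hr => ?_⟩
  have hL : 1 ≤ Lc := Nat.one_le_iff_ne_zero.mpr (NeZero.ne Lc)
  have e : (((Lc ^ 1 : ℕ) : ℤ)) = (Lc : ℤ) := by simp
  have hl0 : ∀ (ρ : Site (d + 1)) (μ : Fin (d + 1)) (y : Site (d + 1)), linAvgAt ρ (0 : Form1 (d + 1) ℝ) Lc μ y = 0 := fun ρ μ y => by
    simpa using linAvgAt_sub ρ (0 : Form1 (d + 1) ℝ) 0 Lc μ y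
  let c₁ : ℝ := (((Lc : ℝ) ^ (d + 1) * stepScale d Lc (lev 1)) * (∏ i ∈ Finset.range 0, (stepScale d Lc (lev (i + 1 + 1)) * ((box (d + 1) Lc).card : ℝ)))⁻¹)
  refine ⟨fun κ' u => c₁ • vhSAt (toSite (rs 1)) d Lc rfl κ' u, fun x => nearBox Lc (blk Lc x), ?_, ?_, ?_, ?_⟩
  · intro κ' u t
    rw [e]
    show c₁ • vhSAt (toSite (rs 1)) d Lc rfl κ' (u + (Lc : ℤ) • t) = _
    rw [vhSAt_translate _ hL]
    rfl
  · intro κ' u x μ α z hz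
    show c₁ * vhSAt (toSite (rs 1)) d Lc rfl κ' u x z (Sum.inr μ) (Sum.inl α) = 0
    rw [vhSAt_inr_inl_eq_zero_of_not_mem hr κ' u x μ α hz, mul_zero]
  · intro κ' x z μ α u hu
    show c₁ * vhSAt (toSite (rs 1)) d Lc rfl κ' u x z (Sum.inr μ) (Sum.inl α) = 0
    rw [vhSAt_inr_inl_eq_zero_of_not_mem_family hr κ' x z μ α hu, mul_zero]
  · intro H B κ x
    rw [e, hsucc]
    simp only [h0, hl0, Finset.prod_range_zero, one_mul, compLinAvgAt_zero, mul_zero, add_zero]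
    have hV : ∀ (κ' : Fin (d + 1)) (u z : Site (d + 1)) (l : Fin (d + 1)),
        (c₁ • vhSAt (toSite (rs 1)) d Lc rfl κ' u) ((Lc : ℤ) • x) z (Sum.inr κ) (Sum.inl l) = c₁ * vhKerAt (toSite (rs 1)) Lc κ x (l, z) (κ', u) := by
      intro κ' u z l
      show c₁ * vhSAt (toSite (rs 1)) d Lc rfl κ' u ((Lc : ℤ) • x) z (Sum.inr κ) (Sum.inl l) = _
      rw [vhSAt_zsmul_inr_inl]
    simp only [hV]
    show _ = c₁ * _
    rw [← tsum_mul_left]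
    refine tsum_congr fun u => ?_
    rw [Finset.mul_sum]
    refine Finset.sum_congr rfl fun κ' _ => ?_
    rw [← mul_assoc, ← tsum_mul_left]
    refine congrArg (fun t : ℝ => t * _) (tsum_congr fun z => ?_)
    rw [Finset.mul_sum]
    exact Finset.sum_congr rfl fun l _ => by rw [mul_assoc]

end DepthOne

end Summit.QuantumFields.BalabanUV.Beta.FP.TorusCompositeClausesInhabited

end
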